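import Summits.Parity.GeneralizedHardyLittlewood.Theorems.GoldbachHeathBrownDispersionHeathBrownMorozUniformSigmaOneCoprime
import Summits.Parity.GeneralizedHardyLittlewood.Theorems.GoldbachHeathBrownDispersionHeathBrownMorozUniformClassDisplay104
import Summits.Parity.GeneralizedHardyLittlewood.Theorems.GoldbachHeathBrownDispersionHeathBrownMorozUniformOfClassLemmas
import Literature.NumberTheory.Sieve.HeathBrownCubicLeadingA
import Literature.NumberTheory.Sieve.HeathBrownCubicPrimesProofs
import Literature.NumberTheory.Sieve.HeathBrownMorozResidueClassesSieve
import Literature.NumberTheory.Sieve.HeathBrownMorozClassTypeI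
import Literature.NumberTheory.Sieve.HeathBrownMorozClassPairCount
import HarnessLib

/-!
# Crux `HeathBrownMorozUniform` (stmt-Parity-19915): S4a, class Type I summed over square-free moduli

Heath-Brown, Acta Math. 186 (2001), Lemma 3.9 / §10 (10.1)–(10.4), for the class family `classPairs X η d a b` of
Heath-Brown–Moroz 2004, Lemma 4.1: the proved glue of the merged skeleton
`Cruxes/HeathBrownMorozUniform/Lines/unit_split_positivity.lean` (Part A: `class_typeI_dyadic`,
`classTypeISqfreeSum_holds` = S4a, the triangle-inequality glue, `classLeadingDifferencing_of_display104`,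
`h39_of_leadingDifferencing`) instantiated at the two LANDED linear-sieve stubs — S3 `classSigmaOneCoprime`
(p560964) and S4b `classDisplay104_of_typeISqfreeSum_of_sigmaOneCoprime` (p562472) — copied letter for letter with
the statement-defs unfolded. This file: `class_typeI_dyadic` and `classTypeISqfreeSum_holds` (S4a, from the landed `class_typeI_A` and
`exists_abs_classCountA_top_sub_le`). Goldbach is not proved by this.

## References

* D. R. Heath-Brown, Acta Math. 186 (2001), Lemma 3.9, §10 (10.1)–(10.4). [cite: HeathBrownActa2001, Lemma 3.9]
* D. R. Heath-Brown, B. Z. Moroz, Proc. London Math. Soc. 88 (2004), Lemma 4.1. [cite: HeathBrownMoroz2004, Lemma 4.1]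
-/

noncomputable section

open Polynomial NumberField Finset Filter Topology Asymptotics

namespace Summit.Parity.GeneralizedHardyLittlewood.Theorems.GoldbachHeathBrownDispersionHeathBrownMorozUniform

open Literature.NumberTheory.Sieve.CubicSieve Literature.NumberTheory.Sieve.CubicPrimes
open Literature.NumberTheory.LFunctions.CubeRootTwoField

open scoped Classical in
/-- **Class Lemma 3.2 summed dyadically** (the class twin of `exists_typeI_dyadic`): from the landed
`class_typeI_A` (with `A = 1`) there are `k, C` — uniform in the class — such that for every reduced admissible
class `(a, b) mod d`, `X ≥ 4(d+2)²`, `η` in the range (2.1) and `1 ≤ B ≤ X³`,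
`∑_{2 ≤ N(R) ≤ B, N(R) □-free} |#𝒜_{cl,R} − main_R| ≤ C (B + X√B + X^{3/2}) (log X)^{k+1}` (at most `7 log X` blocks
`(2^j, 2^{j+1}]`, each bounded by `class_typeI_A` with `(log(2^jX))^c ≤ (5 log X)^k`, `τ(R) ≥ 1`).
[cite: HeathBrownMoroz2004, Lemma 2.4 (2.29)] [cite: HeathBrownActa2001, Lemma 3.2 and §7 p. 40] -/
theorem class_typeI_dyadic :
    ∃ (k : ℕ) (C : ℝ), 0 ≤ C ∧ ∀ d a b : ℕ, 0 < d → a < d → b < d → Nat.Coprime (a ^ 3 + 2 * b ^ 3) d →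
      ∀ X η B : ℝ, 4 * ((d : ℝ) + 2) ^ 2 ≤ X →
      Real.exp (-Real.log X ^ (1 / 3 : ℝ)) ≤ η → η ≤ 1 → 1 ≤ B → B ≤ X ^ 3 →
      ∑ R ∈ (idealsLE ⌊B⌋₊).filter (fun R => 2 ≤ Ideal.absNorm R ∧ Squarefree (Ideal.absNorm R)),
          |(classCountA X η d a b R : ℝ) -
              (if Nat.Coprime d (Ideal.absNorm R) then
                6 * η ^ 2 * X ^ 2 / Real.pi ^ 2 * zetaTwoCorrection d / (d : ℝ) ^ 2 * rho₂ R /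
                  Ideal.absNorm R else 0)| ≤
        C * (B + X * Real.sqrt B + X ^ (3 / 2 : ℝ)) * Real.log X ^ (k + 1) := by
  classical
  obtain ⟨c, C, -, -, hC⟩ := class_typeI_A 1 one_pos
  set k : ℕ := ⌈max c 0⌉₊ with hk
  refine ⟨k, 14 * 5 ^ k * max C 0, by positivity,
    fun d a b hd ha hb hadm X η B hX hηlo hη1 hB1 hBX => ?_⟩
  set 𝓡 := (idealsLE ⌊B⌋₊).filter (fun R => 2 ≤ Ideal.absNorm R ∧ Squarefree (Ideal.absNorm R))
    with h𝓡
  set J : ℕ := ⌊Real.log (B + 1) / Real.log 2⌋₊ with hJ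
  have hd1 : (1 : ℝ) ≤ d := by exact_mod_cast hd
  have hX3 : 3 ≤ X := by nlinarith
  have hX2 : 2 ≤ X := by linarith
  have hX0 : 0 < X := by linarith
  have hX1 : 1 ≤ X := by linarith
  have hηpos : 0 < η := (Real.exp_pos _).trans_le hηlo
  have hl2 : 0 < Real.log 2 := Real.log_pos one_lt_two
  have hlogX1 : 1 ≤ Real.log X := by
    rw [← Real.log_exp 1]
    refine Real.log_le_log (Real.exp_pos 1) ?_
    have := Real.exp_one_lt_d9
    linarith
  have hlogX0 : 0 < Real.log X := by linarith
  have hB0 : 0 < B := by linarith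
  set E : Ideal (𝓞 K) → ℝ := fun R => |(classCountA X η d a b R : ℝ) -
      (if Nat.Coprime d (Ideal.absNorm R) then
        6 * η ^ 2 * X ^ 2 / Real.pi ^ 2 * zetaTwoCorrection d / (d : ℝ) ^ 2 * rho₂ R /
          Ideal.absNorm R else 0)| with hE
  have hE0 : ∀ R, 0 ≤ E R := fun R => abs_nonneg _
  -- every `R` lies in a block `j ≤ J`
  have hmaps : ∀ R ∈ 𝓡, dyadIdx (Ideal.absNorm R) ∈ range (J + 1) := by
    intro R hR
    rw [h𝓡, mem_filter, mem_idealsLE] at hR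
    obtain ⟨hRB, h2, -⟩ := hR
    rw [mem_range, Nat.lt_succ_iff, hJ]
    refine Nat.le_floor (dyadIdx_le_log h2 ?_)
    have : (Ideal.absNorm R : ℝ) ≤ ⌊B⌋₊ := by exact_mod_cast hRB
    linarith [Nat.floor_le hB0.le]
  rw [← sum_fiberwise_of_maps_to hmaps]
  -- the bound for one block
  have h2J : (2 : ℝ) ^ J ≤ B + 1 := two_pow_floor_log_le (by linarith)
  have hblock : ∀ j ∈ range (J + 1),
      ∑ R ∈ 𝓡.filter (fun R => dyadIdx (Ideal.absNorm R) = j), E R ≤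
        max C 0 * (2 * (B + X * Real.sqrt B + X ^ (3 / 2 : ℝ))) * (5 * Real.log X) ^ k := by
    intro j hj
    rw [mem_range, Nat.lt_succ_iff] at hj
    set Q' : ℝ := (2 : ℝ) ^ j with hQ'
    have hQ'1 : 1 ≤ Q' := one_le_pow₀ one_le_two
    have hQ'B : Q' ≤ B + 1 := (pow_le_pow_right₀ one_le_two hj).trans h2J
    have h := hC d a b hd ha hb hadm X η Q' hX hηpos hη1 hQ'1
    have hsub : 𝓡.filter (fun R => dyadIdx (Ideal.absNorm R) = j) ⊆
        (idealsLE ⌊2 * Q'⌋₊).filter (fun R => Q' < (Ideal.absNorm R : ℝ) ∧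
          (Ideal.absNorm R : ℝ) ≤ 2 * Q' ∧ Squarefree (Ideal.absNorm R)) := by
      intro R hR
      rw [mem_filter, h𝓡, mem_filter, mem_idealsLE] at hR
      obtain ⟨⟨-, h2, hsq⟩, hjR⟩ := hR
      have hlt := pow_dyadIdx_lt h2
      have hle := le_pow_dyadIdx_succ (Ideal.absNorm R)
      rw [hjR] at hlt hle
      have hfloor : ⌊2 * Q'⌋₊ = 2 ^ (j + 1) := by
        rw [hQ', show (2 : ℝ) * 2 ^ j = ((2 ^ (j + 1) : ℕ) : ℝ) by push_cast; ring, Nat.floor_natCast]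
      rw [mem_filter, mem_idealsLE, hfloor]
      refine ⟨hle, ?_, ?_, hsq⟩
      · rw [hQ']; exact_mod_cast hlt
      · have : ((Ideal.absNorm R : ℕ) : ℝ) ≤ ((2 ^ (j + 1) : ℕ) : ℝ) := by exact_mod_cast hle
        rw [hQ']
        push_cast at this
        rw [pow_succ] at this
        linarith
    have hpt : ∀ R ∈ 𝓡.filter (fun R => dyadIdx (Ideal.absNorm R) = j), E R ≤
        (idealDivisorCount R : ℝ) ^ 1 * E R := by
      intro R hR
      rw [mem_filter, h𝓡, mem_filter] at hR
      have hR0 : R ≠ ⊥ := fun h0 => by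
        have := hR.1.2.1; rw [h0, Ideal.absNorm_bot] at this; omega
      have hτ : (1 : ℝ) ≤ (idealDivisorCount R : ℝ) ^ 1 := by
        rw [pow_one]; exact_mod_cast one_le_idealDivisorCount hR0
      exact le_mul_of_one_le_left (hE0 R) hτ
    have hnn : ∀ R ∈ (idealsLE ⌊2 * Q'⌋₊).filter (fun R => Q' < (Ideal.absNorm R : ℝ) ∧
          (Ideal.absNorm R : ℝ) ≤ 2 * Q' ∧ Squarefree (Ideal.absNorm R)),
        0 ≤ (idealDivisorCount R : ℝ) ^ 1 * E R :=
      fun R _ => mul_nonneg (by positivity) (hE0 R)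
    -- the logarithm: `log(Q'X)^c ≤ (5 log X)^k`
    have hQX1 : 1 ≤ Real.log (Q' * X) := by
      calc (1 : ℝ) ≤ Real.log X := hlogX1
        _ ≤ Real.log (Q' * X) := Real.log_le_log hX0 (le_mul_of_one_le_left hX0.le hQ'1)
    have hlogQX : Real.log (Q' * X) ≤ 5 * Real.log X := by
      have hQ'X : Q' * X ≤ X ^ 5 := by
        have hB2 : B + 1 ≤ 2 * X ^ 3 := by nlinarith [one_le_pow₀ (n := 3) hX1]
        calc Q' * X ≤ (2 * X ^ 3) * X := by gcongr; linarith
          _ = 2 * X ^ 4 := by ring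
          _ ≤ X * X ^ 4 := by gcongr
          _ = X ^ 5 := by ring
      calc Real.log (Q' * X) ≤ Real.log (X ^ 5) := Real.log_le_log (by positivity) hQ'X
        _ = 5 * Real.log X := by rw [Real.log_pow]; push_cast; ring
    have hck : c ≤ (k : ℝ) := (le_max_left c 0).trans (Nat.le_ceil _)
    have hlogpow : Real.log (Q' * X) ^ c ≤ (5 * Real.log X) ^ k := by
      calc Real.log (Q' * X) ^ c ≤ Real.log (Q' * X) ^ (k : ℝ) :=
            Real.rpow_le_rpow_of_exponent_le hQX1 hck
        _ = Real.log (Q' * X) ^ k := Real.rpow_natCast _ _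
        _ ≤ (5 * Real.log X) ^ k := pow_le_pow_left₀ (by linarith) hlogQX k
    have hgeom : Q' + X * Real.sqrt Q' + X ^ (3 / 2 : ℝ) ≤ 2 * (B + X * Real.sqrt B + X ^ (3 / 2 : ℝ)) := by
      have hs : Real.sqrt Q' ≤ 2 * Real.sqrt B := by
        calc Real.sqrt Q' ≤ Real.sqrt (4 * B) := Real.sqrt_le_sqrt (by linarith)
          _ = 2 * Real.sqrt B := by
              rw [Real.sqrt_mul (by norm_num), show (4 : ℝ) = 2 ^ 2 by norm_num,
                Real.sqrt_sq (by norm_num)]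
      have hX32 : 0 ≤ X ^ (3 / 2 : ℝ) := by positivity
      nlinarith [mul_le_mul_of_nonneg_left hs hX0.le, Real.sqrt_nonneg B]
    calc ∑ R ∈ 𝓡.filter (fun R => dyadIdx (Ideal.absNorm R) = j), E R
        ≤ ∑ R ∈ 𝓡.filter (fun R => dyadIdx (Ideal.absNorm R) = j), (idealDivisorCount R : ℝ) ^ 1 * E R :=
          sum_le_sum hpt
      _ ≤ ∑ R ∈ (idealsLE ⌊2 * Q'⌋₊).filter (fun R => Q' < (Ideal.absNorm R : ℝ) ∧
            (Ideal.absNorm R : ℝ) ≤ 2 * Q' ∧ Squarefree (Ideal.absNorm R)),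
            (idealDivisorCount R : ℝ) ^ 1 * E R :=
          sum_le_sum_of_subset_of_nonneg hsub fun R hR _ => hnn R hR
      _ ≤ C * (Q' + X * Real.sqrt Q' + X ^ (3 / 2 : ℝ)) * Real.log (Q' * X) ^ c := h
      _ ≤ max C 0 * (Q' + X * Real.sqrt Q' + X ^ (3 / 2 : ℝ)) * Real.log (Q' * X) ^ c :=
          mul_le_mul_of_nonneg_right (mul_le_mul_of_nonneg_right (le_max_left _ _) (by positivity))
            (Real.rpow_nonneg (by linarith) _)
      _ ≤ max C 0 * (2 * (B + X * Real.sqrt B + X ^ (3 / 2 : ℝ))) * (5 * Real.log X) ^ k := by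
          gcongr
  -- the number of blocks
  have hJle : ((J + 1 : ℕ) : ℝ) ≤ 7 * Real.log X := by
    have h1 : (J : ℝ) ≤ Real.log (B + 1) / Real.log 2 :=
      Nat.floor_le (div_nonneg (Real.log_nonneg (by linarith)) hl2.le)
    have h2 : Real.log (B + 1) ≤ 4 * Real.log X := by
      have hB2 : B + 1 ≤ X ^ 4 := by nlinarith [one_le_pow₀ (n := 3) hX1]
      calc Real.log (B + 1) ≤ Real.log (X ^ 4) := Real.log_le_log (by linarith) hB2
        _ = 4 * Real.log X := by rw [Real.log_pow]; push_cast; ring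
    have h3 : Real.log (B + 1) / Real.log 2 ≤ 6 * Real.log X := by
      rw [div_le_iff₀ hl2]
      have h69 := Real.log_two_gt_d9
      have : 0.6931471803 * (6 * Real.log X) ≤ Real.log 2 * (6 * Real.log X) :=
        mul_le_mul_of_nonneg_right h69.le (by positivity)
      nlinarith
    push_cast
    linarith
  calc ∑ j ∈ range (J + 1), ∑ R ∈ 𝓡.filter (fun R => dyadIdx (Ideal.absNorm R) = j), E R
      ≤ ∑ j ∈ range (J + 1),
          max C 0 * (2 * (B + X * Real.sqrt B + X ^ (3 / 2 : ℝ))) * (5 * Real.log X) ^ k :=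
        sum_le_sum hblock
    _ = ((J + 1 : ℕ) : ℝ) *
          (max C 0 * (2 * (B + X * Real.sqrt B + X ^ (3 / 2 : ℝ))) * (5 * Real.log X) ^ k) := by
        rw [sum_const, card_range, nsmul_eq_mul]
    _ ≤ (7 * Real.log X) *
          (max C 0 * (2 * (B + X * Real.sqrt B + X ^ (3 / 2 : ℝ))) * (5 * Real.log X) ^ k) :=
        mul_le_mul_of_nonneg_right hJle
          (mul_nonneg (mul_nonneg (le_max_right C 0) (by positivity)) (pow_nonneg (by linarith) k))
    _ = 14 * 5 ^ k * max C 0 * (B + X * Real.sqrt B + X ^ (3 / 2 : ℝ)) * Real.log X ^ (k + 1) := by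
        rw [mul_pow, pow_succ]; ring


open scoped Classical in
/-- **S4a PROVED — class Type I summed over all square-free moduli up to `B`** (the class twin of
`exists_typeI_squarefree_sum_le`): `class_typeI_dyadic` for `N(D) ≥ 2` plus the `D = (1)` term
`exists_abs_classCountA_top_sub_le` (`ρ₂(1) = 1`, `(1, d) = 1`). [cite: HeathBrownMoroz2004, Lemma 2.4 (2.29)]
[cite: HeathBrownActa2001, Lemma 3.2 and §10 p. 62] -/
theorem classTypeISqfreeSum_holds :
  ∀ d a b : ℕ, 0 < d → a < d → b < d → Nat.Coprime (a ^ 3 + 2 * b ^ 3) d →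
    ∃ (k : ℕ) (C : ℝ), 0 ≤ C ∧ ∀ X η B : ℝ, 4 * ((d : ℝ) + 2) ^ 2 ≤ X →
      Real.exp (-Real.log X ^ (1 / 3 : ℝ)) ≤ η → η ≤ 1 → 1 ≤ B → B ≤ X ^ 3 →
        ∑ D ∈ (idealsLE ⌊B⌋₊).filter (fun D => Squarefree (Ideal.absNorm D)),
            |(classCountA X η d a b D : ℝ) -
              (if Nat.Coprime d (Ideal.absNorm D) then
                6 * η ^ 2 * X ^ 2 / Real.pi ^ 2 * zetaTwoCorrection d / (d : ℝ) ^ 2 * rho₂ D /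
                  Ideal.absNorm D else 0)| ≤
          C * (X * (1 + Real.log X) + (B + X * Real.sqrt B + X ^ (3 / 2 : ℝ)) * Real.log X ^ (k + 1)) := by
  classical
  intro d a b hd ha hb hadm
  obtain ⟨k, C₂, hC₂, h₂⟩ := class_typeI_dyadic
  obtain ⟨C₁, hC₁, h₁⟩ := exists_abs_classCountA_top_sub_le (a := a) (b := b) hd hadm
  refine ⟨k, max C₁ C₂, le_max_of_le_left hC₁.le, fun X η B hX hηlo hη1 hB1 hBX => ?_⟩
  have hη0 : 0 ≤ η := le_trans (Real.exp_pos _).le hηlo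
  have hd1 : (1 : ℝ) ≤ d := by exact_mod_cast hd
  have hX2 : 2 ≤ X := by nlinarith
  set S := (idealsLE ⌊B⌋₊).filter (fun D => Squarefree (Ideal.absNorm D)) with hS
  set f : Ideal (𝓞 K) → ℝ := fun D => |(classCountA X η d a b D : ℝ) -
      (if Nat.Coprime d (Ideal.absNorm D) then
        6 * η ^ 2 * X ^ 2 / Real.pi ^ 2 * zetaTwoCorrection d / (d : ℝ) ^ 2 * rho₂ D /
          Ideal.absNorm D else 0)| with hf
  rw [← Finset.sum_filter_add_sum_filter_not S (fun D => 2 ≤ Ideal.absNorm D)]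
  -- the part `N(D) ≥ 2`
  have hbig : ∑ D ∈ S.filter (fun D => 2 ≤ Ideal.absNorm D), f D ≤
      C₂ * (B + X * Real.sqrt B + X ^ (3 / 2 : ℝ)) * Real.log X ^ (k + 1) := by
    have hset : S.filter (fun D => 2 ≤ Ideal.absNorm D) =
        (idealsLE ⌊B⌋₊).filter (fun R => 2 ≤ Ideal.absNorm R ∧ Squarefree (Ideal.absNorm R)) := by
      rw [hS, Finset.filter_filter]
      exact Finset.filter_congr fun D _ => and_comm
    rw [hset]
    exact h₂ d a b hd ha hb hadm X η B hX hηlo hη1 hB1 hBX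
  -- the part `N(D) < 2`, i.e. `D = (1)`
  have hρ : rho₂ (⊤ : Ideal (𝓞 K)) = 1 := by
    rw [rho₂_eq_of_squarefree (by rw [Ideal.absNorm_top]; exact squarefree_one), Ideal.absNorm_top,
      Nat.primeFactors_one, prod_empty]
  have hsmall : ∑ D ∈ S.filter (fun D => ¬2 ≤ Ideal.absNorm D), f D ≤ C₁ * X * (1 + Real.log X) := by
    have hsub : S.filter (fun D => ¬2 ≤ Ideal.absNorm D) ⊆ {⊤} := by
      intro D hD
      rw [mem_filter, hS, mem_filter] at hD
      rw [Finset.mem_singleton]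
      have h0 : Ideal.absNorm D ≠ 0 := Squarefree.ne_zero hD.1.2
      have h1 : Ideal.absNorm D = 1 := by omega
      exact Ideal.absNorm_eq_one_iff.mp h1
    calc ∑ D ∈ S.filter (fun D => ¬2 ≤ Ideal.absNorm D), f D ≤ ∑ D ∈ ({⊤} : Finset (Ideal (𝓞 K))), f D :=
          Finset.sum_le_sum_of_subset_of_nonneg hsub fun D _ _ => abs_nonneg _
      _ = |(classCountA X η d a b ⊤ : ℝ) -
            6 * η ^ 2 * X ^ 2 / Real.pi ^ 2 * zetaTwoCorrection d / (d : ℝ) ^ 2| := by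
          rw [Finset.sum_singleton, hf]
          simp only
          rw [Ideal.absNorm_top, if_pos (Nat.coprime_one_right _), hρ, Nat.cast_one, mul_one, div_one]
      _ ≤ C₁ * X * (1 + Real.log X) := h₁ X η hX2 hη0 hη1
  have hlog : 0 ≤ Real.log X := Real.log_nonneg (by linarith)
  have hT1 : 0 ≤ X * (1 + Real.log X) := by nlinarith
  have hT2 : 0 ≤ (B + X * Real.sqrt B + X ^ (3 / 2 : ℝ)) * Real.log X ^ (k + 1) := by positivity
  calc ∑ D ∈ S.filter (fun D => 2 ≤ Ideal.absNorm D), f D +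
        ∑ D ∈ S.filter (fun D => ¬2 ≤ Ideal.absNorm D), f D
      ≤ C₂ * (B + X * Real.sqrt B + X ^ (3 / 2 : ℝ)) * Real.log X ^ (k + 1) + C₁ * X * (1 + Real.log X) :=
        add_le_add hbig hsmall
    _ ≤ max C₁ C₂ * ((B + X * Real.sqrt B + X ^ (3 / 2 : ℝ)) * Real.log X ^ (k + 1)) +
        max C₁ C₂ * (X * (1 + Real.log X)) := by
        rw [mul_assoc, mul_assoc]
        exact add_le_add (mul_le_mul_of_nonneg_right (le_max_right _ _) hT2)
          (mul_le_mul_of_nonneg_right (le_max_left _ _) hT1)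
    _ = max C₁ C₂ * (X * (1 + Real.log X) + (B + X * Real.sqrt B + X ^ (3 / 2 : ℝ)) * Real.log X ^ (k + 1)) := by
        ring

end Summit.Parity.GeneralizedHardyLittlewood.Theorems.GoldbachHeathBrownDispersionHeathBrownMorozUniform

end
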